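import Literature.NumberTheory.QuadraticForms.LandherrHermitianPlanesIff
import HarnessLib

/-!
# Diagonal hermitian forms over a CM field: isometry, discriminant class, positive index (Sylvester)

Topic `NumberTheory/QuadraticForms`; vocabulary + theorems for Landherr's theorem in rank `n`
(`LandherrHermitianRankN.lean`). Let `L` be a CM field with complex conjugation
`σ = IsCMField.complexConj L` (Mathlib `NumberField.IsCMField`).

* `Landherr.conjTranspose L A = ᵗ(σ A)` — transpose and conjugate entrywise (the CM analogue of `Aᴴ`;
  `(ᵗσA).map τ = (A.map τ)ᴴ` at every complex embedding `τ`, `Landherr.map_conjTranspose`);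
* `Landherr.IsomDiag L b b'` (`b b' : ι → L`) — the diagonal `σ`-hermitian forms `∑ bᵢ xᵢ σ(yᵢ)` and
  `∑ b'ᵢ xᵢ σ(yᵢ)` are isometric: `ᵗ(σG) · diag b · G = diag b'` for some `G` with `det G` a unit; an
  equivalence relation stable under reindexing and orthogonal sums (`IsomDiag.refl/symm/trans/comp_equiv/sum`);
* `Landherr.posCount L τ b = #{i | Re τ(bᵢ) > 0}` — the positive index at the complex embedding `τ`;
* the two invariants of an isometry: the discriminant class `∏ bᵢ ≡ ∏ b'ᵢ mod N(Lˣ)` (`IsomDiag.disc`) and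
  the positive index at every `τ` (`IsomDiag.posCount_eq`) — the latter by **Sylvester's law of inertia** in
  the form of the inequality `Landherr.card_pos_le_of_congr` for a complex congruence
  `Gᴴ · diag d · G = diag d'` (a dimension count: a kernel vector of `ℂ^{p'} → ℂ^{p}` for `p < p'` would
  make the real form `u ↦ Re ∑ dᵢ‖uᵢ‖²` both `> 0` and `≤ 0`).

Provenance: `pub-hodgecm` reproduction of the arithmetic inputs of Deligne's "Hodge cycles on abelian
varieties" §4–5 (package file `Proofs/LandherrRankN.lean` §1–§2, gen 7), ported to Mathlib vocabulary.

## References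

* W. Landherr, *Äquivalenz Hermitescher Formen über einem beliebigen algebraischen Zahlkörper*, Abh. Math.
  Sem. Univ. Hamburg 11 (1936) 245–248 [Landherr1936HermitianForms].
* G. Shimura, *Arithmetic of hermitian forms*, Doc. Math. 13 (2008) 739–774, Thm. 2.2.
* W. Scharlau, *Quadratic and Hermitian Forms*, Grundlehren 270 (1985), Ch. 10 [Scharlau1985HermitianForms].
-/

noncomputable section

open NumberField
open scoped Matrix ComplexConjugate

namespace Literature.NumberTheory.QuadraticForms

namespace Landherr

variable (L : Type) [Field L] [NumberField L] [IsCMField L]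

/-! ## §1. Conjugate transpose and isometry of diagonal hermitian forms -/

section Algebra

variable {ι κ μ : Type}

/-- `ᵗ(σ A)`: transpose followed by complex conjugation of the CM field `L` entrywise. [folklore] -/
def conjTranspose (A : Matrix ι κ L) : Matrix κ ι L := A.transpose.map (IsCMField.complexConj L)

/-- Entries of the conjugate transpose: `(ᵗσA) i j = σ (A j i)`. [folklore] -/
theorem conjTranspose_apply (A : Matrix ι κ L) (i : κ) (j : ι) : conjTranspose L A i j = IsCMField.complexConj L (A j i) := rfl

/-- `ᵗσ(AB) = ᵗσB · ᵗσA`. [folklore] -/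
theorem conjTranspose_mul [Fintype μ] (A : Matrix ι μ L) (B : Matrix μ κ L) : conjTranspose L (A * B) = conjTranspose L B * conjTranspose L A := by
  unfold conjTranspose
  rw [Matrix.transpose_mul, Matrix.map_mul]

/-- `ᵗσ1 = 1`. [folklore] -/
theorem conjTranspose_one [DecidableEq ι] : conjTranspose L (1 : Matrix ι ι L) = 1 := by
  unfold conjTranspose
  rw [Matrix.transpose_one, Matrix.map_one _ (map_zero _) (map_one _)]

/-- `ᵗσ0 = 0`. [folklore] -/
theorem conjTranspose_zero : conjTranspose L (0 : Matrix ι κ L) = 0 := by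
  unfold conjTranspose
  rw [Matrix.transpose_zero, Matrix.map_zero _ (map_zero _)]

/-- `det ᵗσA = σ (det A)`. [folklore] -/
theorem det_conjTranspose [Fintype ι] [DecidableEq ι] (A : Matrix ι ι L) : (conjTranspose L A).det = IsCMField.complexConj L A.det := by
  unfold conjTranspose
  rw [← AlgEquiv.mapMatrix_apply, ← AlgEquiv.map_det, Matrix.det_transpose]

/-- Conjugate transpose of a reindexed matrix. [folklore] -/
theorem conjTranspose_submatrix (A : Matrix ι ι L) (e : κ → ι) (f : κ → ι) :
    conjTranspose L (A.submatrix e f) = (conjTranspose L A).submatrix f e := by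
  unfold conjTranspose
  rw [Matrix.transpose_submatrix, Matrix.submatrix_map]

/-- Conjugate transpose of a block matrix. [folklore] -/
theorem conjTranspose_fromBlocks (A : Matrix ι ι L) (B : Matrix ι κ L) (C : Matrix κ ι L) (D : Matrix κ κ L) :
    conjTranspose L (Matrix.fromBlocks A B C D) = Matrix.fromBlocks (conjTranspose L A) (conjTranspose L C) (conjTranspose L B) (conjTranspose L D) := by
  unfold conjTranspose
  rw [Matrix.fromBlocks_transpose, Matrix.fromBlocks_map]

/-- The map `τ` of an `L`-matrix: `τ(ᵗσA) = (τA)ᴴ`. [folklore] -/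
theorem map_conjTranspose (τ : L →+* ℂ) (A : Matrix ι κ L) : (conjTranspose L A).map τ = (A.map τ)ᴴ := by
  ext i j
  simp [conjTranspose, Matrix.conjTranspose_apply, IsCMField.complexEmbedding_complexConj]

variable [Fintype ι] [DecidableEq ι]

/-- **Isometry of diagonal hermitian forms.**  `IsomDiag L b b'` (`b b' : ι → L`): there is an invertible
`G` with `ᵗ(σG) · diag b · G = diag b'`, i.e. the hermitian forms `∑ bᵢ xᵢ σ(yᵢ)` and `∑ b'ᵢ xᵢ σ(yᵢ)` on `L^ι`
are isometric. [folklore] -/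
def IsomDiag (b b' : ι → L) : Prop :=
  ∃ G : Matrix ι ι L, IsUnit G.det ∧ conjTranspose L G * Matrix.diagonal b * G = Matrix.diagonal b'

namespace IsomDiag

/-- Isometry of diagonal hermitian forms is reflexive. [folklore] -/
theorem refl (b : ι → L) : IsomDiag L b b :=
  ⟨1, by simp, by rw [conjTranspose_one, Matrix.one_mul, Matrix.mul_one]⟩

variable {L}

/-- Equal diagonal forms are isometric. [folklore] -/
theorem of_eq {b b' : ι → L} (h : b = b') : IsomDiag L b b' := h ▸ refl L b

/-- Isometry of diagonal hermitian forms is transitive. [folklore] -/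
theorem trans {b b' b'' : ι → L} (h₁ : IsomDiag L b b') (h₂ : IsomDiag L b' b'') : IsomDiag L b b'' := by
  obtain ⟨G₁, hG₁, e₁⟩ := h₁
  obtain ⟨G₂, hG₂, e₂⟩ := h₂
  refine ⟨G₁ * G₂, by rw [Matrix.det_mul]; exact hG₁.mul hG₂, ?_⟩
  calc conjTranspose L (G₁ * G₂) * Matrix.diagonal b * (G₁ * G₂)
      = conjTranspose L G₂ * (conjTranspose L G₁ * Matrix.diagonal b * G₁) * G₂ := by
        rw [conjTranspose_mul]; simp only [Matrix.mul_assoc]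
    _ = Matrix.diagonal b'' := by rw [e₁, e₂]

/-- Isometry of diagonal hermitian forms is symmetric (inverse matrix). [folklore] -/
theorem symm {b b' : ι → L} (h : IsomDiag L b b') : IsomDiag L b' b := by
  obtain ⟨G, hG, e⟩ := h
  refine ⟨G⁻¹, Matrix.isUnit_nonsing_inv_det G hG, ?_⟩
  have h1 : conjTranspose L G⁻¹ * conjTranspose L G = 1 := by rw [← conjTranspose_mul, Matrix.mul_nonsing_inv G hG, conjTranspose_one]
  calc conjTranspose L G⁻¹ * Matrix.diagonal b' * G⁻¹
      = conjTranspose L G⁻¹ * (conjTranspose L G * Matrix.diagonal b * G) * G⁻¹ := by rw [e]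
    _ = (conjTranspose L G⁻¹ * conjTranspose L G) * Matrix.diagonal b * (G * G⁻¹) := by
        simp only [Matrix.mul_assoc]
    _ = Matrix.diagonal b := by rw [h1, Matrix.mul_nonsing_inv G hG, Matrix.one_mul, Matrix.mul_one]

/-- Transport along a bijection of index sets (pull back). [folklore] -/
theorem comp_equiv {κ : Type} [Fintype κ] [DecidableEq κ] {b b' : κ → L} (h : IsomDiag L b b')
    (e : ι ≃ κ) : IsomDiag L (b ∘ e) (b' ∘ e) := by
  obtain ⟨G, hG, hE⟩ := h
  refine ⟨G.submatrix e e, by rwa [Matrix.det_submatrix_equiv_self], ?_⟩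
  rw [conjTranspose_submatrix, ← Matrix.submatrix_diagonal_equiv, Matrix.submatrix_mul_equiv,
    Matrix.submatrix_mul_equiv, hE, Matrix.submatrix_diagonal_equiv]

/-- Transport along a bijection of index sets (push forward). [folklore] -/
theorem of_comp_equiv {κ : Type} [Fintype κ] [DecidableEq κ] {b b' : κ → L} (e : ι ≃ κ)
    (h : IsomDiag L (b ∘ e) (b' ∘ e)) : IsomDiag L b b' := by
  have h' := h.comp_equiv e.symm
  have hb : (b ∘ e) ∘ e.symm = b := by ext x; simp
  have hb' : (b' ∘ e) ∘ e.symm = b' := by ext x; simp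
  rwa [hb, hb'] at h'

/-- Orthogonal sum of two isometries. [folklore] -/
theorem sum {κ : Type} [Fintype κ] [DecidableEq κ] {b₁ b₁' : ι → L} {b₂ b₂' : κ → L}
    (h₁ : IsomDiag L b₁ b₁') (h₂ : IsomDiag L b₂ b₂') :
    IsomDiag L (Sum.elim b₁ b₂) (Sum.elim b₁' b₂') := by
  obtain ⟨G₁, hG₁, e₁⟩ := h₁
  obtain ⟨G₂, hG₂, e₂⟩ := h₂
  refine ⟨Matrix.fromBlocks G₁ 0 0 G₂, ?_, ?_⟩
  · rw [Matrix.det_fromBlocks_zero₂₁]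
    exact hG₁.mul hG₂
  · rw [conjTranspose_fromBlocks, conjTranspose_zero, conjTranspose_zero, ← Matrix.fromBlocks_diagonal, Matrix.fromBlocks_multiply,
      Matrix.fromBlocks_multiply, ← Matrix.fromBlocks_diagonal]
    simp [e₁, e₂]

/-- From `IsUnit G.det` to the general linear group: the `GL` form of an isometry. [folklore] -/
theorem exists_gl {b b' : ι → L} (h : IsomDiag L b b') :
    ∃ g : GL ι L, conjTranspose L (g : Matrix ι ι L) * Matrix.diagonal b * (g : Matrix ι ι L) = Matrix.diagonal b' := by
  obtain ⟨G, hG, e⟩ := h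
  exact ⟨Matrix.nonsingInvUnit G hG, e⟩

/-- An element of `GL` conjugating `diag b` to `diag b'` witnesses `IsomDiag`. [folklore] -/
theorem of_gl {b b' : ι → L} (g : GL ι L)
    (e : conjTranspose L (g : Matrix ι ι L) * Matrix.diagonal b * (g : Matrix ι ι L) = Matrix.diagonal b') :
    IsomDiag L b b' :=
  ⟨g, Matrix.isUnits_det_units g, e⟩

end IsomDiag

end Algebra

/-! ## §2. Invariants of an isometry: discriminant class and positive index (inertia) -/

section Invariants

variable {ι : Type} [Fintype ι]

/-- The number of indices `i` at which `τ (b i)` has positive real part — for `σ`-fixed `b i` (so that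
`τ (b i) ∈ ℝ^×`) this is the positive index of the real diagonal form `diag (τ b)` at the real place under `τ`. [folklore] -/
def posCount (τ : L →+* ℂ) (b : ι → L) : ℕ := (Finset.univ.filter fun i => 0 < (τ (b i)).re).card

omit [NumberField L] [IsCMField L] in
/-- `posCount` as a sum of indicators. [folklore] -/
theorem posCount_eq_sum (τ : L →+* ℂ) (b : ι → L) :
    posCount L τ b = ∑ i, (if 0 < (τ (b i)).re then 1 else 0) := by
  unfold posCount
  rw [Finset.card_filter]

omit [NumberField L] [IsCMField L] in
/-- `posCount` is invariant under reindexing. [folklore] -/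
theorem posCount_comp_equiv {κ : Type} [Fintype κ] (τ : L →+* ℂ) (b : κ → L) (e : ι ≃ κ) :
    posCount L τ (b ∘ e) = posCount L τ b := by
  rw [posCount_eq_sum, posCount_eq_sum]
  exact Fintype.sum_equiv e _ _ (fun x => rfl)

omit [NumberField L] [IsCMField L] in
/-- `posCount` of an orthogonal sum is additive. [folklore] -/
theorem posCount_sum_elim {κ : Type} [Fintype κ] (τ : L →+* ℂ) (b₁ : ι → L) (b₂ : κ → L) :
    posCount L τ (Sum.elim b₁ b₂) = posCount L τ b₁ + posCount L τ b₂ := by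
  rw [posCount_eq_sum, posCount_eq_sum, posCount_eq_sum, Fintype.sum_sum_type]
  rfl

omit [NumberField L] [IsCMField L] in
/-- `posCount ≤ rank`. [folklore] -/
theorem posCount_le_card (τ : L →+* ℂ) (b : ι → L) : posCount L τ b ≤ Fintype.card ι :=
  Finset.card_filter_le _ _ |>.trans (Finset.card_univ (α := ι)).le

omit [NumberField L] [IsCMField L] in
/-- `posCount = rank` iff the form is positive definite at `τ`. [folklore] -/
theorem posCount_eq_card_iff (τ : L →+* ℂ) (b : ι → L) :
    posCount L τ b = Fintype.card ι ↔ ∀ i, 0 < (τ (b i)).re := by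
  unfold posCount
  rw [← Finset.card_univ, Finset.card_filter_eq_iff]
  simp

omit [NumberField L] [IsCMField L] in
/-- `posCount = 0` iff no diagonal entry is positive at `τ`. [folklore] -/
theorem posCount_eq_zero_iff (τ : L →+* ℂ) (b : ι → L) :
    posCount L τ b = 0 ↔ ∀ i, ¬ 0 < (τ (b i)).re := by
  unfold posCount
  rw [Finset.card_eq_zero, Finset.filter_eq_empty_iff]
  simp

/-- The real quadratic form `u ↦ Re ∑ dᵢ |uᵢ|²` on `ℂ^ι`. [folklore] -/
def realQ (d : ι → ℂ) (u : ι → ℂ) : ℝ := ∑ i, (d i).re * ‖u i‖ ^ 2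

variable {L}
variable [DecidableEq ι]

/-- **Discriminant class.**  An isometry `ᵗ(σG)·diag b·G = diag b'` forces `∏ bᵢ = (∏ b'ᵢ) · N(z)` with
`z = (det G)⁻¹`. [folklore] -/
theorem IsomDiag.disc {b b' : ι → L} (h : IsomDiag L b b') :
    ∃ z : L, z ≠ 0 ∧ ∏ i, b i = (∏ i, b' i) * (z * IsCMField.complexConj L z) := by
  obtain ⟨G, hG, e⟩ := h
  have hD : G.det ≠ 0 := hG.ne_zero
  have edet : IsCMField.complexConj L G.det * (∏ i, b i) * G.det = ∏ i, b' i := by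
    have h := congrArg Matrix.det e
    rwa [Matrix.det_mul, Matrix.det_mul, det_conjTranspose, Matrix.det_diagonal, Matrix.det_diagonal] at h
  refine ⟨G.det⁻¹, inv_ne_zero hD, ?_⟩
  have hσD : IsCMField.complexConj L G.det ≠ 0 := (map_ne_zero (IsCMField.complexConj L)).mpr hD
  rw [map_inv₀, ← edet]
  field_simp

/-- `Re (u* · diag d · u) = ∑ Re dᵢ ‖uᵢ‖²`. [folklore] -/
theorem re_star_dotProduct_diagonal_mulVec (d u : ι → ℂ) :
    (star u ⬝ᵥ (Matrix.diagonal d *ᵥ u)).re = realQ d u := by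
  unfold realQ dotProduct
  rw [Complex.re_sum]
  refine Finset.sum_congr rfl fun i _ => ?_
  rw [Matrix.mulVec_diagonal, Pi.star_apply, mul_left_comm, Complex.star_def, Complex.conj_mul']
  rw [← Complex.ofReal_pow, Complex.re_mul_ofReal]

/-- Change of variables: if `Gᴴ · diag d · G = diag d'` over `ℂ` then `realQ d (G u) = realQ d' u`. [folklore] -/
theorem realQ_mulVec {d d' : ι → ℂ} {G : Matrix ι ι ℂ}
    (hG : Gᴴ * Matrix.diagonal d * G = Matrix.diagonal d') (u : ι → ℂ) :
    realQ d (G *ᵥ u) = realQ d' u := by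
  rw [← re_star_dotProduct_diagonal_mulVec, ← re_star_dotProduct_diagonal_mulVec, Matrix.star_mulVec,
    ← Matrix.dotProduct_mulVec, Matrix.mulVec_mulVec, Matrix.mulVec_mulVec, hG]

/-- An isometry over `L` gives, at every complex embedding `τ`, a complex congruence
`(τG)ᴴ · diag (τ b) · τG = diag (τ b')`. [folklore] -/
theorem IsomDiag.map_embedding {b b' : ι → L} {G : Matrix ι ι L}
    (e : conjTranspose L G * Matrix.diagonal b * G = Matrix.diagonal b') (τ : L →+* ℂ) :
    (G.map τ)ᴴ * Matrix.diagonal (τ ∘ b) * G.map τ = Matrix.diagonal (τ ∘ b') := by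
  have h := congrArg (fun M : Matrix ι ι L => M.map τ) e
  simp only [Matrix.map_mul, map_conjTranspose, Matrix.diagonal_map (map_zero τ)] at h
  exact h

/-- Extension by zero from the coordinates in `S`. [folklore] -/
def extZero (S : Finset ι) : ({i // i ∈ S} → ℂ) →ₗ[ℂ] (ι → ℂ) where
  toFun u i := if h : i ∈ S then u ⟨i, h⟩ else 0
  map_add' u v := by
    ext i
    by_cases h : i ∈ S <;> simp [h]
  map_smul' r u := by
    ext i
    by_cases h : i ∈ S <;> simp [h]

omit [Fintype ι] in
/-- Extension by zero on a coordinate in `S`. [folklore] -/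
theorem extZero_apply_mem (S : Finset ι) (u : {i // i ∈ S} → ℂ) (i : {i // i ∈ S}) :
    extZero S u i = u i := by
  simp [extZero, i.2]

omit [Fintype ι] in
/-- Extension by zero vanishes off `S`. [folklore] -/
theorem extZero_apply_not_mem (S : Finset ι) (u : {i // i ∈ S} → ℂ) {i : ι} (hi : i ∉ S) :
    extZero S u i = 0 := by
  simp [extZero, hi]

/-- **Sylvester's law of inertia (the inequality).**  A complex congruence `Gᴴ·diag d·G = diag d'` forces
`#{i | Re d'ᵢ > 0} ≤ #{i | Re dᵢ > 0}`: otherwise the positive coordinate space of `d'` (dimension `p'`)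
would contain a non-zero vector whose image under `G` has vanishing `d`-positive coordinates (a kernel vector
of a linear map to a space of dimension `p < p'`), on which the form is both `> 0` and `≤ 0`. [cite: Landherr1936HermitianForms] -/
theorem card_pos_le_of_congr {d d' : ι → ℂ} {G : Matrix ι ι ℂ}
    (hG : Gᴴ * Matrix.diagonal d * G = Matrix.diagonal d') :
    (Finset.univ.filter fun i => 0 < (d' i).re).card ≤ (Finset.univ.filter fun i => 0 < (d i).re).card := by
  classical
  set P : Finset ι := Finset.univ.filter fun i => 0 < (d i).re with hP
  set P' : Finset ι := Finset.univ.filter fun i => 0 < (d' i).re with hP'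
  have memP : ∀ i, i ∈ P ↔ 0 < (d i).re := fun i => by rw [hP]; simp
  have memP' : ∀ i, i ∈ P' ↔ 0 < (d' i).re := fun i => by rw [hP']; simp
  by_contra hlt
  rw [not_le] at hlt
  -- the linear map  u ↦ (G · ext u)|_P  from ℂ^{P'} to ℂ^{P}
  let φ : ({i // i ∈ P'} → ℂ) →ₗ[ℂ] ({i // i ∈ P} → ℂ) :=
    (LinearMap.funLeft ℂ ℂ (Subtype.val : {i // i ∈ P} → ι)) ∘ₗ G.mulVecLin ∘ₗ extZero P'
  have hdim : Module.finrank ℂ ({i // i ∈ P} → ℂ) < Module.finrank ℂ ({i // i ∈ P'} → ℂ) := by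
    rw [Module.finrank_fintype_fun_eq_card, Module.finrank_fintype_fun_eq_card, Fintype.card_coe,
      Fintype.card_coe]
    exact hlt
  obtain ⟨u, hu, hu0⟩ := (Submodule.ne_bot_iff _).mp (LinearMap.ker_ne_bot_of_finrank_lt (f := φ) hdim)
  rw [LinearMap.mem_ker] at hu
  set w : ι → ℂ := extZero P' u with hw
  set v : ι → ℂ := G *ᵥ w with hv
  have hvP : ∀ i, i ∈ P → v i = 0 := by
    intro i hi
    have := congrFun hu ⟨i, hi⟩
    simpa [φ, LinearMap.funLeft_apply] using this
  -- the form is ≤ 0 on v …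
  have hle : realQ d v ≤ 0 := by
    refine Finset.sum_nonpos fun i _ => ?_
    by_cases hi : i ∈ P
    · rw [hvP i hi]; simp
    · have hdi : (d i).re ≤ 0 := not_lt.mp fun h => hi ((memP i).mpr h)
      exact mul_nonpos_of_nonpos_of_nonneg hdi (by positivity)
  -- … and > 0 on w
  have hgt : 0 < realQ d' w := by
    obtain ⟨j, hj⟩ : ∃ j : {i // i ∈ P'}, u j ≠ 0 := Function.ne_iff.mp hu0
    refine Finset.sum_pos' (fun i _ => ?_) ⟨j, Finset.mem_univ _, ?_⟩
    · by_cases hi : i ∈ P'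
      · have hdi : 0 < (d' i).re := (memP' i).mp hi
        exact mul_nonneg hdi.le (by positivity)
      · rw [hw, extZero_apply_not_mem P' u hi]; simp
    · have hdj : 0 < (d' j).re := (memP' j) |>.mp j.2
      rw [hw, extZero_apply_mem]
      exact mul_pos hdj (by positivity)
  have := realQ_mulVec hG w
  rw [← hv] at this
  linarith

/-- **Inertia.**  An isometry of diagonal hermitian forms over `L` preserves the positive index at every
complex embedding. [cite: Landherr1936HermitianForms] -/
theorem IsomDiag.posCount_eq {b b' : ι → L} (h : IsomDiag L b b') (τ : L →+* ℂ) :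
    posCount L τ b = posCount L τ b' := by
  apply le_antisymm
  · obtain ⟨G, -, e⟩ := h.symm
    exact card_pos_le_of_congr (IsomDiag.map_embedding e τ)
  · obtain ⟨G, -, e⟩ := h
    exact card_pos_le_of_congr (IsomDiag.map_embedding e τ)

end Invariants

end Landherr

end Literature.NumberTheory.QuadraticForms

end
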